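import Literature.Computability.Complexity.GraphCanonizationRefiner
import HarnessLib

/-!
# The canoniser as a list program, I: data, counts, switch bits and codes on lists

First layer of the MACHINE for the discharge of `babaiLuks1983_canonicalForm`: the states of the
section/individualization canoniser (`GraphCanonizationScheme.lean`, `CGCanon.canon`) written as
LISTS OF NUMERALS AND BITS — the format an `FP` string program reads — together with the
dictionary back to the `Fin k` notions. Vertices are `0, …, k-1`; a graph is its list of
adjacency rows (`CGProg.adjOf G`), a vertex subset its membership bit mask (`CGProg.maskOf W`), a
colouring its list of colours (`CGProg.colOf c`).

* accessors `bitAt`, `natAt`, `adjAt` and their values on `adjOf`/`maskOf`/`colOf`;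
* `individualizeL`, `liftL` = `individualize`, `liftCol` (`individualizeL_colOf`, `liftL_eq`);
* counts: `cellCardL`, `crossL`, the switch bit `switchL` and the switched adjacency `swAdjL`
  = `cellCard`, `crossEdges`, `Switch`, `swGraph` of `within G W` for the lifted colouring
  (`cellCardL_colOf`, `crossL_eq`, `switchL_eq`, `swAdjL_eq`; [Laubner2011, Def. 3.3.2]);
* `codeL` = `CGCanon.code` (`codeL_eq`), `wlistL` = `W.sort` (`wlistL_eq`).

All list functions are written as maps / filters over `List.range k` so that
`GraphCanonizationProgramFP*.lean` can type them with the `CodeFP` combinators.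

## References

* B. Laubner, PhD thesis, HU Berlin 2011, doi:10.18452/16335, Def. 3.3.2, §3.4. [Laubner2011]
* S. Arora, B. Barak, *Computational Complexity: A Modern Approach*, CUP 2009, §0.1 (codes of
  graphs, tuples and lists). [AroraBarakCC2009]
-/

namespace Literature.Computability.Complexity

open Literature.Combinatorics.SimpleGraph Finset ColourRefinementScheme

open scoped Classical

noncomputable section

namespace CGProg

variable {k : ℕ}

/-! ### List data and accessors -/

/-- Bit `i` of a bit list (`false` past the end). [folklore] -/
def bitAt (l : List Bool) (i : ℕ) : Bool := l.getD i false

/-- Item `i` of a numeral list (`0` past the end). [folklore] -/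
def natAt (l : List ℕ) (i : ℕ) : ℕ := l.getD i 0

/-- Entry `(u, v)` of a list of adjacency rows. [folklore] -/
def adjAt (A : List (List Bool)) (u v : ℕ) : Bool := bitAt (A.getD u []) v

/-- The adjacency rows of a graph on `Fin k`. [cite: AroraBarakCC2009, §0.1] -/
def adjOf (G : SimpleGraph (Fin k)) : List (List Bool) := List.ofFn fun i : Fin k => List.ofFn fun j : Fin k => decide (G.Adj i j)

/-- The membership mask of a vertex subset. [folklore] -/
def maskOf (W : Finset (Fin k)) : List Bool := List.ofFn fun i : Fin k => decide (i ∈ W)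

/-- The colour list of a colouring. [folklore] -/
def colOf (c : Fin k → ℕ) : List ℕ := List.ofFn c

/-- `List.ofFn` over `Fin k` is a map over `range k`. [folklore] -/
theorem ofFn_eq_map_range {α : Type} (f : ℕ → α) : (List.ofFn fun j : Fin k => f j) = (List.range k).map f := by
  apply List.ext_getElem (by simp)
  intro i h₁ h₂; simp

/-- A map over `range k` agreeing with `f` on `Fin k` is `List.ofFn f`. [folklore] -/
theorem map_range_eq_ofFn {α : Type} {g : ℕ → α} {f : Fin k → α} (h : ∀ i : Fin k, g i = f i) : (List.range k).map g = List.ofFn f := by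
  apply List.ext_getElem (by simp)
  intro i h₁ h₂
  rw [List.length_map, List.length_range] at h₁
  simp [h ⟨i, h₁⟩]

/-- Reading `List.ofFn` inside the range. [folklore] -/
theorem getD_ofFn {α : Type} (f : Fin k → α) (d : α) (i : Fin k) : (List.ofFn f).getD i.val d = f i := by
  rw [List.getD_eq_getElem _ _ (by simp), List.getElem_ofFn]

/-- Reading `List.ofFn` outside the range. [folklore] -/
theorem getD_ofFn_of_le {α : Type} (f : Fin k → α) (d : α) {i : ℕ} (hi : k ≤ i) : (List.ofFn f).getD i d = d :=
  List.getD_eq_default _ _ (by simpa using hi)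

/-- `adjOf G` has `k` rows. [folklore] -/
@[simp] theorem length_adjOf (G : SimpleGraph (Fin k)) : (adjOf G).length = k := List.length_ofFn

/-- `maskOf W` has `k` bits. [folklore] -/
@[simp] theorem length_maskOf (W : Finset (Fin k)) : (maskOf W).length = k := List.length_ofFn

/-- `colOf c` has `k` items. [folklore] -/
@[simp] theorem length_colOf (c : Fin k → ℕ) : (colOf c).length = k := List.length_ofFn

/-- Adjacency entries of `adjOf G`. [folklore] -/
@[simp] theorem adjAt_adjOf (G : SimpleGraph (Fin k)) (i j : Fin k) : adjAt (adjOf G) i j = decide (G.Adj i j) := by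
  unfold adjAt bitAt adjOf; rw [getD_ofFn, getD_ofFn]

/-- Mask entries. [folklore] -/
@[simp] theorem bitAt_maskOf (W : Finset (Fin k)) (i : Fin k) : bitAt (maskOf W) i = decide (i ∈ W) := getD_ofFn _ _ _

/-- Colour entries. [folklore] -/
@[simp] theorem natAt_colOf (c : Fin k → ℕ) (i : Fin k) : natAt (colOf c) i = c i := getD_ofFn _ _ _

/-- Counting over `Fin k` is filtering `range k`. [folklore] -/
theorem card_filter_univ_eq_length (p : Fin k → Prop) [DecidablePred p] (q : ℕ → Bool) (hq : ∀ i : Fin k, q i = decide (p i)) :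
    (univ.filter p).card = ((List.range k).filter q).length := by
  have hnd : ((List.range k).filter q).Nodup := List.nodup_range.filter _
  rw [← List.toFinset_card_of_nodup hnd, ← card_map Fin.valEmbedding]
  congr 1
  ext n
  simp only [mem_map, mem_filter, mem_univ, true_and, Fin.valEmbedding_apply, List.mem_toFinset, List.mem_filter, List.mem_range]
  constructor
  · rintro ⟨i, hi, rfl⟩
    exact ⟨i.isLt, by rw [hq i]; exact decide_eq_true hi⟩
  · rintro ⟨hn, hqn⟩
    refine ⟨⟨n, hn⟩, ?_, rfl⟩
    have := hq ⟨n, hn⟩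
    rw [hqn] at this
    exact of_decide_eq_true this.symm

/-- Pairs over `Fin k × Fin k` are filtering `range k ×ˢ range k`. [folklore] -/
theorem card_filter_univ_prod_eq_length (p : Fin k × Fin k → Prop) [DecidablePred p] (q : ℕ × ℕ → Bool)
    (hq : ∀ i j : Fin k, q (i, j) = decide (p (i, j))) :
    (univ.filter p).card = (((List.range k).product (List.range k)).filter q).length := by
  have hnd : (((List.range k).product (List.range k)).filter q).Nodup := (List.nodup_range.product List.nodup_range).filter _
  rw [← List.toFinset_card_of_nodup hnd, ← card_map (Fin.valEmbedding.prodMap Fin.valEmbedding)]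
  congr 1
  ext ⟨a, b⟩
  simp only [mem_map, mem_filter, mem_univ, true_and, List.mem_toFinset, List.mem_filter, List.pair_mem_product, List.mem_range,
    Function.Embedding.coe_prodMap, Fin.valEmbedding_apply, Prod.exists, Prod.map_apply, Prod.mk.injEq]
  constructor
  · rintro ⟨i, j, hij, rfl, rfl⟩
    exact ⟨⟨i.isLt, j.isLt⟩, by rw [hq i j]; exact decide_eq_true hij⟩
  · rintro ⟨⟨ha, hb⟩, hqab⟩
    refine ⟨⟨a, ha⟩, ⟨b, hb⟩, ?_, rfl, rfl⟩
    have := hq ⟨a, ha⟩ ⟨b, hb⟩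
    rw [hqab] at this
    exact of_decide_eq_true this.symm

/-! ### Individualization and lifting -/

/-- Individualization on lists: `x` gets `0`, every other colour is shifted up. [cite: Laubner2011, §3.2.4] -/
def individualizeL (col : List ℕ) (x : ℕ) : List ℕ := (List.range col.length).map fun w => if w = x then 0 else natAt col w + 1

/-- `individualizeL` is `individualize`. [folklore] -/
theorem individualizeL_colOf (c : Fin k → ℕ) (x : Fin k) : individualizeL (colOf c) x.val = colOf (individualize c x) := by
  unfold individualizeL colOf
  rw [List.length_ofFn]
  refine map_range_eq_ofFn fun i => ?_
  simp only [individualize, natAt, getD_ofFn, Fin.val_inj]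

/-- The lifted colouring on lists: `col + 1` on the mask, `0` off it. [folklore] -/
def liftL (mask : List Bool) (col : List ℕ) : List ℕ := (List.range mask.length).map fun v => if bitAt mask v then natAt col v + 1 else 0

/-- `liftL` is `liftCol`. [folklore] -/
theorem liftL_eq (W : Finset (Fin k)) (c : Fin k → ℕ) : liftL (maskOf W) (colOf c) = colOf (CGCanon.liftCol W c) := by
  unfold liftL colOf
  rw [length_maskOf]
  refine map_range_eq_ofFn fun i => ?_
  by_cases hi : i ∈ W
  · simp [bitAt_maskOf, natAt, hi]
  · simp [bitAt_maskOf, hi]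

/-! ### Counts, switch bits, switched adjacency -/

/-- Adjacency within the mask. [folklore] -/
def adjW (A : List (List Bool)) (mask : List Bool) (u v : ℕ) : Bool := bitAt mask u && bitAt mask v && adjAt A u v

/-- `adjW` is adjacency of `within G W`. [folklore] -/
theorem adjW_eq (G : SimpleGraph (Fin k)) (W : Finset (Fin k)) (u v : Fin k) :
    adjW (adjOf G) (maskOf W) u v = decide ((CGCanon.within G W).Adj u v) := by
  unfold adjW
  rw [bitAt_maskOf, bitAt_maskOf, adjAt_adjOf]
  by_cases hu : u ∈ W <;> by_cases hv : v ∈ W <;> by_cases h : G.Adj u v <;> simp [CGCanon.within_adj, hu, hv, h]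

/-- The size of the class of colour `a` (over all `k` vertices). [cite: Laubner2011, Def. 3.3.2] -/
def cellCardL (n : ℕ) (col : List ℕ) (a : ℕ) : ℕ := ((List.range n).filter fun w => decide (natAt col w = a)).length

/-- `cellCardL` is `cellCard`. [folklore] -/
theorem cellCardL_colOf (ρ : Fin k → ℕ) (a : ℕ) : cellCardL k (colOf ρ) a = cellCard ρ a := by
  unfold cellCardL cellCard
  exact (card_filter_univ_eq_length _ _ fun i => by simp [natAt_colOf]).symm

/-- The number of ordered adjacent pairs from colour `a` to colour `b` within the mask. [cite: Laubner2011, §3.3.2 (N)] -/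
def crossL (n : ℕ) (A : List (List Bool)) (mask : List Bool) (col : List ℕ) (a b : ℕ) : ℕ :=
  (((List.range n).product (List.range n)).filter fun p => decide (natAt col p.1 = a) && decide (natAt col p.2 = b) && adjW A mask p.1 p.2).length

/-- `crossL` is `crossEdges` of `within G W`. [folklore] -/
theorem crossL_eq (G : SimpleGraph (Fin k)) (W : Finset (Fin k)) (ρ : Fin k → ℕ) (a b : ℕ) :
    crossL k (adjOf G) (maskOf W) (colOf ρ) a b = crossEdges (CGCanon.within G W) ρ a b := by
  unfold crossL crossEdges
  refine (card_filter_univ_prod_eq_length _ _ fun i j => ?_).symm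
  rw [natAt_colOf, natAt_colOf, adjW_eq]
  by_cases h1 : ρ i = a <;> by_cases h2 : ρ j = b <;> by_cases h3 : (CGCanon.within G W).Adj i j <;> simp_all

/-- The switch bit of the block `(a, b)`. [cite: Laubner2011, Def. 3.3.2] -/
def switchL (n : ℕ) (A : List (List Bool)) (mask : List Bool) (col : List ℕ) (a b : ℕ) : Bool :=
  decide (cellCardL n col a * cellCardL n col b < 2 * crossL n A mask col a b)

/-- `switchL` is `Switch` of `within G W`. [folklore] -/
theorem switchL_eq (G : SimpleGraph (Fin k)) (W : Finset (Fin k)) (ρ : Fin k → ℕ) (a b : ℕ) :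
    switchL k (adjOf G) (maskOf W) (colOf ρ) a b = decide (Switch (CGCanon.within G W) ρ a b) := by
  unfold switchL Switch
  rw [cellCardL_colOf, cellCardL_colOf, crossL_eq]
  exact decide_eq_decide.2 Iff.rfl

/-- The switched adjacency of `(u, v)`. [cite: Laubner2011, Def. 3.3.2] -/
def swAdjL (n : ℕ) (A : List (List Bool)) (mask : List Bool) (col : List ℕ) (u v : ℕ) : Bool :=
  !decide (u = v) && decide (adjW A mask u v = !switchL n A mask col (natAt col u) (natAt col v))

/-- `swAdjL` is adjacency of the switching-equivalent graph of `within G W` for `ρ`. [folklore] -/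
theorem swAdjL_eq (G : SimpleGraph (Fin k)) (W : Finset (Fin k)) (ρ : Fin k → ℕ) (u v : Fin k) :
    swAdjL k (adjOf G) (maskOf W) (colOf ρ) u v = decide ((swGraph (CGCanon.within G W) ρ).Adj u v) := by
  unfold swAdjL
  rw [adjW_eq, natAt_colOf, natAt_colOf, switchL_eq, Bool.eq_iff_iff, decide_eq_true_iff, swGraph_adj]
  by_cases h1 : u = v <;> by_cases h2 : (CGCanon.within G W).Adj u v <;> by_cases h3 : Switch (CGCanon.within G W) ρ (ρ u) (ρ v) <;>
    simp_all [Fin.val_inj]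

/-- In particular for the lifted colouring: the switched graph of the state. [folklore] -/
theorem swAdjL_liftL (G : SimpleGraph (Fin k)) (W : Finset (Fin k)) (c : Fin k → ℕ) (u v : Fin k) :
    swAdjL k (adjOf G) (maskOf W) (liftL (maskOf W) (colOf c)) u v = decide ((CGCanon.swG G W c).Adj u v) := by
  rw [liftL_eq, swAdjL_eq]; exact decide_eq_decide.2 Iff.rfl

/-! ### Codes and vertex lists -/

/-- The code of an ordering on lists: adjacency rows along `ord`, then the colours. [cite: Laubner2011, Thm. 3.4.3] -/
def codeL (A : List (List Bool)) (col : List ℕ) (ord : List ℕ) : List (List Bool) × List ℕ :=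
  (ord.map fun u => ord.map fun v => adjAt A u v, ord.map fun u => natAt col u)

/-- `codeL` is `CGCanon.code`. [folklore] -/
theorem codeL_eq (G : SimpleGraph (Fin k)) (c : Fin k → ℕ) (ord : List (Fin k)) :
    codeL (adjOf G) (colOf c) (ord.map Fin.val) = ofLex (CGCanon.code G c ord) := by
  unfold codeL CGCanon.code
  simp only [ofLex_toLex, List.map_map]
  refine Prod.ext (List.map_congr_left fun u _ => ?_) (List.map_congr_left fun u _ => ?_)
  · simp only [Function.comp_apply]
    exact List.map_congr_left fun v _ => by simp
  · simp

/-- The sorted list of the vertices in the mask. [folklore] -/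
def wlistL (mask : List Bool) : List ℕ := (List.range mask.length).filter fun v => bitAt mask v

/-- `wlistL` is `W.sort`. [folklore] -/
theorem wlistL_eq (W : Finset (Fin k)) : wlistL (maskOf W) = (W.sort (· ≤ ·)).map Fin.val := by
  unfold wlistL
  rw [length_maskOf]
  have hsorted : ((W.sort (· ≤ ·)).map Fin.val).SortedLT := by
    rw [List.sortedLT_iff_pairwise, List.pairwise_map]
    exact (W.sortedLT_sort).pairwise.imp fun h => Fin.lt_def.1 h
  have hsorted' : ((List.range k).filter fun v => bitAt (maskOf W) v).SortedLT :=
    List.sortedLT_iff_pairwise.2 (List.pairwise_lt_range.filter _)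
  refine List.SortedLT.eq_of_mem_iff hsorted' hsorted fun n => ?_  -- membership characterisation
  simp only [List.mem_filter, List.mem_range, List.mem_map, mem_sort]
  constructor
  · rintro ⟨hn, hb⟩
    refine ⟨⟨n, hn⟩, ?_, rfl⟩
    have := bitAt_maskOf W ⟨n, hn⟩
    rw [hb] at this
    exact of_decide_eq_true this.symm
  · rintro ⟨i, hi, rfl⟩
    exact ⟨i.isLt, by rw [bitAt_maskOf]; exact decide_eq_true hi⟩

end CGProg

end

end Literature.Computability.Complexity
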